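/-
COR-CM (cell pub-hodgecm2) — Δ2 ORIENTATION AUDIT, TEST T5 (consistency of a displayed theta-side supply hypothesis): THE LIFT TEST.
Seat rekey-l1-cmside-a g1 (prover-pub-hodgecm2-rekey-l1-cmside-a-g1-0), author seat of the W-B leaf `CorCM/Rekey/HThetaAnti.lean`, 2026-08-23.
THEOREMS ONLY; nothing landed is edited or restated; no named fact, no `sorry`.  HC_CM is NOT proved; «Δ2 BRIDGE CLOSED» is NOT claimed.
-/
import Summits.HodgeConjecture.CorCM.D2Bridge.OrientationT2BlockVanishing
import Summits.HodgeConjecture.HodgeCM.Model.HThetaJunctionR2B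
import Summits.HodgeConjecture.HodgeCM.Model.LiuDictionaryTowerFixed
import HarnessLib

/-!
# Δ2 orientation audit, test T5: a theta class lifted into a block that is READ IN TYPE `(0,1)` is zero

The W-B edition of the re-keyed END displays a SIXTH hypothesis `hΘ′` (`CorCM/Rekey/HThetaAnti.lean`,
`SInstance.HThetaAntiAll`): at every good context and slot `i`, every theta class `ω` of the pin theta model lifts to a tower vector
`cf` (`TowerLevel.res cf = ω`) inside `block j` of the pinned dictionary, `j` the index ANTI-isometric to the slot line.  The tree's own
supply ✔ `SInstance.hJ_ROGT'C_block` is the same sentence at the ISOMETRIC index `j₀`.  mc-theta-3's T5 item (pub-hodgecm/STATUS 22:34Z ∕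
22:35Z) asks whether such a lift hypothesis is CONSISTENT with a Hodge-type reading of the blocks.  This file settles the kernel part,
reading-agnostically, for ANY index `j` and ANY lift family:

* §1 `thetaOf_pin_mem_hodgeF_one` — every theta class of the pin `thetaSpaceInputOf … S` (any adelic side `S`, any slot, any level) lies in
  `F¹H¹(P_Γ; ℂ)` of the model universe (regime branch: the class-map datum's `H10` IS `F¹`, `classMapDatumOf_H10`; off-regime branch: the
  theta classes are `{0}`).
* §2 `towerLift_class_eq_zero_of_blockZeroOne` — T5 CORE at the pinned dictionary `𝔇 := liuDictionaryPin … V I line`, ANY index `j`: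
  a class `ω ∈ F¹H¹(P_Γ)` with a tower lift `cf` (`TowerLevel.res cf = ω`, `ofLevel cf ∈ 𝔇.block j`) is `0` as soon as `𝔇.block j` is READ
  IN TYPE `(0,1)` — the typed clause (D) of wb-9's T2 (`∃ Γ₁, ∀ Γ' ≤ Γ₁, ∀ y ∈ block j, y ∈ H^{K(Γ')} → res Γ' y ∈ H^{0,1}(P_{Γ'})`),
  by wb-9's ✔ `not_block_pin_res_subset_piece_zero_one_of_res_mem_F_one` (pull-back to the common level is injective and `F¹`-preserving,
  `F¹ ∩ H^{0,1} = 0`).  No `Thm418C`, no `Prop413`, no block disjointness, no «ker res» analysis is needed: the identity component alone decides.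
* §3 `thetaOf_eq_zero_of_liftFamily_of_blockZeroOne` — T5-A, the DISPLAYED SHAPE: any lift family «`∃ j, P j ∧ ∀ Γ ω, ∃ cf, res cf = ω ∧
  ofLevel cf ∈ block j`» (for `P j :=` «`(line j).scalar = −(z z̄·a_i)`» and the re-keyed pin, whose `block` is the live pin's by `rfl`, this
  is `SInstance.HThetaAnti … V c i` VERBATIM) together with (D) at every `P`-index forces EVERY theta class of that slot to vanish; with one
  non-zero class the pair is contradictory (`not_liftFamily_of_blockZeroOne_of_thetaOf_ne_zero`).
* §4 `thetaOf_eq_zero_of_isometric_blockZeroOne` — T5-B, NO displayed hypothesis at all: by the THEOREM `hJ_ROGT'C_block`, reading the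
  ISOMETRIC block of slot `i` in type `(0,1)` forces every theta class of slot `i` to vanish (`not_isometric_blockZeroOne_of_thetaOf_ne_zero`:
  one non-zero theta class REFUTES that reading) — ORIENTATION-MEMO §8 ∕ mc-theta-3's «with or without hΘ′» in kernel form.

READING (for the memo writers, not used by the kernel): under the re-keyed dictionary (`PhiMu′ j := ῑ₁ ∈ Φ^δ(scalar j)`) the print
[Liu2021, Prop. 4.13 + Thm. 4.15 proof ∕ Lem. D.2: «`ω(μ,ε,χ) ⊂ H¹_{B,τ′}` is of type (1,0) iff `τ′ ∈ Φ_μ`»] read at `τ′ = ῑ₁` types the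
ISOMETRIC block of a good slot (`ι₁ ∈ Φ^δ(a_i)`, so `ῑ₁ ∉ Φ^δ`) as `(0,1)` — §4 says the tree's theta supply is then EMPTY (all classes zero);
read at `τ′ = ι₁` it types the ANTI-isometric block as `(0,1)` — §3 says `hΘ′` then EMPTIES the theta supply.  Either way a W-B∕W-C END that
displays a Hodge-typed block clause next to `hΘ′` (resp. next to nothing) is consistent only in the theta-vacuous regime.
-/

set_option autoImplicit false

noncomputable section

open HodgeCM HodgeCM.Model HodgeCM.Model.SInstance HodgeCM.Model.ThetaAdelicSide HodgeCM.Model.LiuIndex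
open HodgeCM.Model.ThetaSpace HodgeCM.Model.TowerLevel HodgeCM.Model.TowerCarrier HodgeCM.Literature.Theta
open HodgeCM.Literature.Theta.LiuAlbaneseModuleDatum
open HodgeCM.Model.HypCensus HodgeCM.Model.SupplyInstance HodgeCM.Model.ArchSideTerm
open Literature.AlgebraicGeometry.HodgeTheory Literature.NumberTheory.Automorphic.PicardCM
open Literature.NumberTheory.Transcendental (Arapura2012_Cor_15_4_6)
open Literature.AlgebraicGeometry.ShimuraVarieties
open Literature.NumberTheory.Automorphic Literature.NumberTheory.Automorphic.UnitaryGroup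
open Literature.NumberTheory.GelbartRogawski1991 Literature.NumberTheory.GelbartRogawski1991.UnitaryDualPair
open Literature.Geometry.ComplexHyperbolic.BallModel (U21 x₀)
open NumberField MulAction WeightForms

namespace Summit.HodgeConjecture.CorCM.D2Bridge

/-! ## §1 Theta classes of the pin are `F¹`-classes of the model universe -/

section ThetaF

variable (S : ∀ {L : CMField} {ι₁ : L →+* ℂ} (V : HermSpace3 L ι₁) (c : SeesawCtx L), ThetaAdelicSide V c)
variable {L : CMField} {ι₁ : L →+* ℂ} (V : HermSpace3 L ι₁) (c : SeesawCtx L) (k : Fin 4) (Γ : Level V)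

/-- **Every theta class of the pin lies in `F¹H¹(P_Γ; ℂ)`.**  In the regime (`V.Hm` anisotropic) the pin's class-map datum is
`classMapDatumOf …`, whose `H10` is the universe's `F¹` (`classMapDatumOf_H10`, `rfl`); off the regime the datum is the zero datum and
the only theta class is `0`. [folklore] -/
theorem thetaOf_pin_mem_hodgeF_one
    (hHD : exists_isReal_hodgeModel) (hI : hodgePQ_independent_of_hodgeModel)
    (h₁ : BallQuotientUniformised) (h₃ : CMAbelianVarietyRealised)
    {ω : (picardCMUniverse hHD hI h₁ h₃).CohC ((picardCMUniverse hHD hI h₁ h₃).pms L ι₁ V Γ) 1}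
    (hω : ω ∈ thetaOf _ (thetaClassInputOf _ (fun V c => thetaSpaceInputOf hHD hI h₁ h₃ S V c)) V c k Γ) :
    ω ∈ ((picardCMUniverse hHD hI h₁ h₃).hodge ((picardCMUniverse hHD hI h₁ h₃).pms L ι₁ V Γ) 1).F 1 := by
  by_cases h : IsAnisotropic L V.Hm
  · rw [thetaOf_thetaSpaceInputOf_of_isAnisotropic hHD hI h₁ h₃ S V c k Γ h] at hω
    exact thetaClasses_subset _ _ _ hω
  · rw [thetaOf_thetaClassInputOf, thetaSpaceInputOf_of_not_isAnisotropic hHD hI h₁ h₃ S V c h] at hω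
    have h0 : ω = 0 := by
      have hbot := thetaClasses_subset _ _ _ hω
      have e : ((thetaSpaceInputOff hHD hI h₁ h₃ (S V c)).D Γ).H10 = ⊥ := rfl
      rw [e] at hbot
      exact (Submodule.mem_bot ℂ).1 hbot
    rw [h0]
    exact Submodule.zero_mem _

end ThetaF

/-! ## §2 T5 CORE at the pinned dictionary: a tower lift into a `(0,1)`-read block kills an `F¹`-class -/

section Core

variable {L : CMField} {ι₁ : L →+* ℂ} (V : HermSpace3 L ι₁) (I : Type) (line : I → SplitLineE V)

/-- **T5 CORE.**  `𝔇 := liuDictionaryPin … V I line`, ANY index `j`.  If `𝔇.block j` is READ IN TYPE `(0,1)` below some level (the typed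
clause (D) of T2), then every class `ω ∈ F¹H¹(P_Γ; ℂ)` that is the identity-component value `TowerLevel.res cf` of a level-`Γ` tower family
`cf` with `ofLevel cf ∈ 𝔇.block j` is `0`.  (wb-9's `not_block_pin_res_subset_piece_zero_one_of_res_mem_F_one`, contraposed; the lift is
`Γ.K`-fixed by `mem_fixedBy_ofTower_iff`, and `𝔇.res Γ (ofLevel cf) = TowerLevel.res cf` by `ofTower_res_ofLevel`.)
[cite: VoisinHodgeI2002, §7.3.2] -/
theorem towerLift_class_eq_zero_of_blockZeroOne
    (hHD : exists_isReal_hodgeModel) (hI : hodgePQ_independent_of_hodgeModel)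
    (h₁ : BallQuotientUniformised) (h₃ : CMAbelianVarietyRealised) (hA : Arapura2012_Cor_15_4_6)
    (j : I)
    (hD : ∃ Γ₁ : Level V, ∀ Γ' ≤ Γ₁, ∀ y ∈ (liuDictionaryPin hHD hI h₁ h₃ hA V I line).block j,
      y ∈ fixedBy Γ'.K (liuDictionaryPin hHD hI h₁ h₃ hA V I line).H →
        (liuDictionaryPin hHD hI h₁ h₃ hA V I line).res Γ' y ∈
          ((picardCMUniverse hHD hI h₁ h₃).hodge ((picardCMUniverse hHD hI h₁ h₃).pms L ι₁ V Γ') 1).piece 0 1)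
    {Γ : Level V} (hΓ : Γ.BelowConjThree)
    {ω : (picardCMUniverse hHD hI h₁ h₃).CohC ((picardCMUniverse hHD hI h₁ h₃).pms L ι₁ V Γ) 1}
    (hF : ω ∈ ((picardCMUniverse hHD hI h₁ h₃).hodge ((picardCMUniverse hHD hI h₁ h₃).pms L ι₁ V Γ) 1).F 1)
    (hlift : ∃ cf : towerLevel hHD hI (ballQuotientUniformisedDatum_of h₁) h₃ hA Γ hΓ,
      TowerLevel.res hHD hI (ballQuotientUniformisedDatum_of h₁) h₃ hA cf = ω ∧
        (ofLevel hHD hI (ballQuotientUniformisedDatum_of h₁) h₃ hA Γ hΓ cf :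
            (liuDictionaryPin hHD hI h₁ h₃ hA V I line).H) ∈
          (liuDictionaryPin hHD hI h₁ h₃ hA V I line).block j) :
    ω = 0 := by
  obtain ⟨cf, hres, hblock⟩ := hlift
  by_contra hne
  have hfix : (ofLevel hHD hI (ballQuotientUniformisedDatum_of h₁) h₃ hA Γ hΓ cf :
        (liuDictionaryPin hHD hI h₁ h₃ hA V I line).H) ∈
      fixedBy Γ.K (liuDictionaryPin hHD hI h₁ h₃ hA V I line).H :=
    (LiuDictionary.mem_fixedBy_ofTower_iff hHD hI h₁ h₃ hA _ _ _ _ _ hΓ).2 ⟨cf, rfl⟩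
  have hres' : (liuDictionaryPin hHD hI h₁ h₃ hA V I line).res Γ
        (ofLevel hHD hI (ballQuotientUniformisedDatum_of h₁) h₃ hA Γ hΓ cf) = ω := by
    rw [← hres]
    exact LiuDictionary.ofTower_res_ofLevel hHD hI h₁ h₃ hA _ _ _ _ _ hΓ cf
  exact not_block_pin_res_subset_piece_zero_one_of_res_mem_F_one V I line hHD hI h₁ h₃ hA j Γ hΓ _ hblock hfix
    (hres' ▸ hF) (hres' ▸ hne) hD

end Core

/-! ## §3 T5-A: a DISPLAYED lift family (the shape of `hΘ′`) + a `(0,1)`-reading of its blocks ⟹ the slot's theta supply is empty -/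

section LiftFamily

variable (S : ∀ {L : CMField} {ι₁ : L →+* ℂ} (V : HermSpace3 L ι₁) (c : SeesawCtx L), ThetaAdelicSide V c)
variable {L : CMField} {ι₁ : L →+* ℂ} (V : HermSpace3 L ι₁) (c : SeesawCtx L) (I : Type) (line : I → SplitLineE V)

/-- **T5-A (displayed shape).**  `𝔇 := liuDictionaryPin … V I line`, theta side `S`, slot `k`, index predicate `P`.  A lift family
«`∃ j, P j ∧ ∀ Γ below conj-three, ∀ ω ∈ thetaOf …, ∃ cf, TowerLevel.res cf = ω ∧ ofLevel cf ∈ 𝔇.block j`» — for `S := SROGT'C …`,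
`I := I V (repAt a_k) (muLiu ι₁ rep)`, `P j :=` «`∃ z ≠ 0, (line j).scalar = −(z z̄·a_k)`» and the re-keyed pin (same `block`, `rfl`) this
is the W-B binder `SInstance.HThetaAnti … V c k` VERBATIM — together with the `(0,1)`-reading (D) of `𝔇.block j` at every `P`-index
forces EVERY theta class of slot `k` (every level below conj-three) to be `0`. [cite: VoisinHodgeI2002, §7.3.2] -/
theorem thetaOf_eq_zero_of_liftFamily_of_blockZeroOne
    (hHD : exists_isReal_hodgeModel) (hI : hodgePQ_independent_of_hodgeModel)
    (h₁ : BallQuotientUniformised) (h₃ : CMAbelianVarietyRealised) (hA : Arapura2012_Cor_15_4_6)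
    (k : Fin 4) (P : I → Prop)
    (hΘ : ∃ j : I, P j ∧ ∀ (Γ : Level V) (hΓ : Γ.BelowConjThree),
      ∀ ω ∈ thetaOf _ (thetaClassInputOf _ (fun V c => thetaSpaceInputOf hHD hI h₁ h₃ S V c)) V c k Γ,
        ∃ cf : towerLevel hHD hI (ballQuotientUniformisedDatum_of h₁) h₃ hA Γ hΓ,
          TowerLevel.res hHD hI (ballQuotientUniformisedDatum_of h₁) h₃ hA cf = ω ∧
            (ofLevel hHD hI (ballQuotientUniformisedDatum_of h₁) h₃ hA Γ hΓ cf :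
                (liuDictionaryPin hHD hI h₁ h₃ hA V I line).H) ∈
              (liuDictionaryPin hHD hI h₁ h₃ hA V I line).block j)
    (hD : ∀ j : I, P j → ∃ Γ₁ : Level V, ∀ Γ' ≤ Γ₁, ∀ y ∈ (liuDictionaryPin hHD hI h₁ h₃ hA V I line).block j,
      y ∈ fixedBy Γ'.K (liuDictionaryPin hHD hI h₁ h₃ hA V I line).H →
        (liuDictionaryPin hHD hI h₁ h₃ hA V I line).res Γ' y ∈
          ((picardCMUniverse hHD hI h₁ h₃).hodge ((picardCMUniverse hHD hI h₁ h₃).pms L ι₁ V Γ') 1).piece 0 1)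
    (Γ : Level V) (hΓ : Γ.BelowConjThree)
    {ω : (picardCMUniverse hHD hI h₁ h₃).CohC ((picardCMUniverse hHD hI h₁ h₃).pms L ι₁ V Γ) 1}
    (hω : ω ∈ thetaOf _ (thetaClassInputOf _ (fun V c => thetaSpaceInputOf hHD hI h₁ h₃ S V c)) V c k Γ) :
    ω = 0 := by
  obtain ⟨j, hPj, hfam⟩ := hΘ
  exact towerLift_class_eq_zero_of_blockZeroOne V I line hHD hI h₁ h₃ hA j (hD j hPj) hΓ
    (thetaOf_pin_mem_hodgeF_one S V c k Γ hHD hI h₁ h₃ hω) (hfam Γ hΓ ω hω)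

/-- **T5-A, inconsistency form.**  A displayed lift family of the `hΘ′` shape, the `(0,1)`-reading of its blocks and ONE non-zero theta
class of the slot are jointly contradictory. [cite: VoisinHodgeI2002, §7.3.2] -/
theorem not_liftFamily_of_blockZeroOne_of_thetaOf_ne_zero
    (hHD : exists_isReal_hodgeModel) (hI : hodgePQ_independent_of_hodgeModel)
    (h₁ : BallQuotientUniformised) (h₃ : CMAbelianVarietyRealised) (hA : Arapura2012_Cor_15_4_6)
    (k : Fin 4) (P : I → Prop)
    (hD : ∀ j : I, P j → ∃ Γ₁ : Level V, ∀ Γ' ≤ Γ₁, ∀ y ∈ (liuDictionaryPin hHD hI h₁ h₃ hA V I line).block j,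
      y ∈ fixedBy Γ'.K (liuDictionaryPin hHD hI h₁ h₃ hA V I line).H →
        (liuDictionaryPin hHD hI h₁ h₃ hA V I line).res Γ' y ∈
          ((picardCMUniverse hHD hI h₁ h₃).hodge ((picardCMUniverse hHD hI h₁ h₃).pms L ι₁ V Γ') 1).piece 0 1)
    {Γ : Level V} (hΓ : Γ.BelowConjThree)
    {ω : (picardCMUniverse hHD hI h₁ h₃).CohC ((picardCMUniverse hHD hI h₁ h₃).pms L ι₁ V Γ) 1}
    (hω : ω ∈ thetaOf _ (thetaClassInputOf _ (fun V c => thetaSpaceInputOf hHD hI h₁ h₃ S V c)) V c k Γ) (hne : ω ≠ 0) :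
    ¬ ∃ j : I, P j ∧ ∀ (Γ : Level V) (hΓ : Γ.BelowConjThree),
      ∀ ω ∈ thetaOf _ (thetaClassInputOf _ (fun V c => thetaSpaceInputOf hHD hI h₁ h₃ S V c)) V c k Γ,
        ∃ cf : towerLevel hHD hI (ballQuotientUniformisedDatum_of h₁) h₃ hA Γ hΓ,
          TowerLevel.res hHD hI (ballQuotientUniformisedDatum_of h₁) h₃ hA cf = ω ∧
            (ofLevel hHD hI (ballQuotientUniformisedDatum_of h₁) h₃ hA Γ hΓ cf :
                (liuDictionaryPin hHD hI h₁ h₃ hA V I line).H) ∈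
              (liuDictionaryPin hHD hI h₁ h₃ hA V I line).block j :=
  fun hΘ => hne (thetaOf_eq_zero_of_liftFamily_of_blockZeroOne S V c I line hHD hI h₁ h₃ hA k P hΘ hD Γ hΓ hω)

end LiftFamily

/-! ## §4 T5-B: NO displayed hypothesis — the tree's ISOMETRIC supply `hJ_ROGT'C_block` against a `(0,1)`-reading of its block -/

section Isometric

variable
  (hGR : ∀ {L : CMField} {ι₁ : L →+* ℂ} (V : HermSpace3 L ι₁) (c : SeesawCtx L),
    (cmSplittingDatum (L : Type) finProdFinEquiv (frameD V) (frameD_real V) (frameD_ne V) (dW c.D) (dW_real c.D)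
      (dW_ne c.D)).CompatibleSplitting)
  (hGR₀ : ∀ {L : CMField} {ι₁ : L →+* ℂ} (V : HermSpace3 L ι₁) (c : SeesawCtx L),
    (cmSplittingDatum (L : Type) (e₁) (frameD V) (frameD_real V) (frameD_ne V) (lineVec (L : Type) (dW c.D 0))
      (fun _ => dW_real c.D 0) (fun _ => dW_ne c.D 0)).CompatibleSplitting)
  (hGR₁ : ∀ {L : CMField} {ι₁ : L →+* ℂ} (V : HermSpace3 L ι₁) (c : SeesawCtx L),
    (cmSplittingDatum (L : Type) (e₁) (frameD V) (frameD_real V) (frameD_ne V) (lineVec (L : Type) (dW c.D 1))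
      (fun _ => dW_real c.D 1) (fun _ => dW_ne c.D 1)).CompatibleSplitting)
  (hGR₂ : ∀ {L : CMField} {ι₁ : L →+* ℂ} (V : HermSpace3 L ι₁) (c : SeesawCtx L),
    (cmSplittingDatum (L : Type) (e₁) (frameD V) (frameD_real V) (frameD_ne V) (lineVec (L : Type) (dW' c.D 0))
      (fun _ => dW'_real c.D 0) (fun _ => dW'_ne c.D 0)).CompatibleSplitting)
  (hGR₃ : ∀ {L : CMField} {ι₁ : L →+* ℂ} (V : HermSpace3 L ι₁) (c : SeesawCtx L),
    (cmSplittingDatum (L : Type) (e₁) (frameD V) (frameD_real V) (frameD_ne V) (lineVec (L : Type) (dW' c.D 1))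
      (fun _ => dW'_real c.D 1) (fun _ => dW'_ne c.D 1)).CompatibleSplitting)
  (μ : ∀ {L : CMField}, SeesawCtx L → Fin 4 → NumberField.InfinitePlace (L : Type) → ℤ)
  (hΔ₁ : ∀ {L : CMField} {ι₁ : L →+* ℂ} (V : HermSpace3 L ι₁) (c : SeesawCtx L), ∀ hc : GOG V c,
    slotTypeVec V c (hGR V c) (hGR₀ V c) (hGR₁ V c) (hGR₂ V c) (hGR₃ V c) (hG_GOG V c hc) 1 -
      slotTypeVec V c (hGR V c) (hGR₀ V c) (hGR₁ V c) (hGR₂ V c) (hGR₃ V c) (hG_GOG V c hc) 0 = μ c 1 - μ c 0)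
  (hΔ₂ : ∀ {L : CMField} {ι₁ : L →+* ℂ} (V : HermSpace3 L ι₁) (c : SeesawCtx L), ∀ hc : GOG V c,
    slotTypeVec V c (hGR V c) (hGR₀ V c) (hGR₁ V c) (hGR₂ V c) (hGR₃ V c) (hG_GOG V c hc) 2 -
      slotTypeVec V c (hGR V c) (hGR₀ V c) (hGR₁ V c) (hGR₂ V c) (hGR₃ V c) (hG_GOG V c hc) 0 = μ c 2 - μ c 0)
  (hΔ₃ : ∀ {L : CMField} {ι₁ : L →+* ℂ} (V : HermSpace3 L ι₁) (c : SeesawCtx L), ∀ hc : GOG V c,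
    slotTypeVec V c (hGR V c) (hGR₀ V c) (hGR₁ V c) (hGR₂ V c) (hGR₃ V c) (hG_GOG V c hc) 3 -
      slotTypeVec V c (hGR V c) (hGR₀ V c) (hGR₁ V c) (hGR₂ V c) (hGR₃ V c) (hG_GOG V c hc) 0 = μ c 3 - μ c 0)

variable {L : CMField} {ι₁ : L →+* ℂ} (V : HermSpace3 L ι₁) (c : SeesawCtx L)

/-- **T5-B (no displayed hypothesis).**  At a good context (`GOG V c`, `V.Hm` anisotropic) and slot `i`, for the pin theta model
`SROGT'C …` and the pinned dictionary at `a_i`: if the block of EVERY index ISOMETRIC to the slot line is READ IN TYPE `(0,1)` (the typed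
(D) of T2), then every theta class of slot `i` (every level below conj-three) is `0` — the tree's own supply ✔ `hJ_ROGT'C_block` lifts each
class into ONE isometric block, and §2 applies.  ORIENTATION-MEMO §8 in kernel form («with or without `hΘ′`»). [cite: VoisinHodgeI2002, §7.3.2] -/
theorem thetaOf_eq_zero_of_isometric_blockZeroOne
    (hHD : exists_isReal_hodgeModel) (hI : hodgePQ_independent_of_hodgeModel)
    (h₁ : BallQuotientUniformised) (h₃ : CMAbelianVarietyRealised) (hA : Arapura2012_Cor_15_4_6)
    (hc : GOG V c) (hV : IsAnisotropic L V.Hm) (i : Fin 4)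
    (hD : ∀ j : I V (repAt (⟨c.D.a i, c.D.a_real i, c.D.a_ne i⟩ : RealScalar L)) (muLiu ι₁ GramClass.rep),
      (∃ z : (L : Type), z ≠ 0 ∧
        (line V (repAt (⟨c.D.a i, c.D.a_real i, c.D.a_ne i⟩ : RealScalar L)) (muLiu ι₁ GramClass.rep) j).scalar =
          z * conjRingHomK L z * c.D.a i) →
      ∃ Γ₁ : Level V, ∀ Γ' ≤ Γ₁,
        ∀ y ∈ (liuDictionaryPin hHD hI h₁ h₃ hA V
            (I V (repAt (⟨c.D.a i, c.D.a_real i, c.D.a_ne i⟩ : RealScalar L)) (muLiu ι₁ GramClass.rep))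
            (line V (repAt (⟨c.D.a i, c.D.a_real i, c.D.a_ne i⟩ : RealScalar L)) (muLiu ι₁ GramClass.rep))).block j,
          y ∈ fixedBy Γ'.K (liuDictionaryPin hHD hI h₁ h₃ hA V
            (I V (repAt (⟨c.D.a i, c.D.a_real i, c.D.a_ne i⟩ : RealScalar L)) (muLiu ι₁ GramClass.rep))
            (line V (repAt (⟨c.D.a i, c.D.a_real i, c.D.a_ne i⟩ : RealScalar L)) (muLiu ι₁ GramClass.rep))).H →
          (liuDictionaryPin hHD hI h₁ h₃ hA V
            (I V (repAt (⟨c.D.a i, c.D.a_real i, c.D.a_ne i⟩ : RealScalar L)) (muLiu ι₁ GramClass.rep))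
            (line V (repAt (⟨c.D.a i, c.D.a_real i, c.D.a_ne i⟩ : RealScalar L)) (muLiu ι₁ GramClass.rep))).res Γ' y ∈
            ((picardCMUniverse hHD hI h₁ h₃).hodge ((picardCMUniverse hHD hI h₁ h₃).pms L ι₁ V Γ') 1).piece 0 1)
    (Γ : Level V) (hΓ : Γ.BelowConjThree)
    {ω : (picardCMUniverse hHD hI h₁ h₃).CohC ((picardCMUniverse hHD hI h₁ h₃).pms L ι₁ V Γ) 1}
    (hω : ω ∈ thetaOf _ (thetaClassInputOf _ (fun V c => thetaSpaceInputOf hHD hI h₁ h₃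
        (SROGT'C @hGR @hGR₀ @hGR₁ @hGR₂ @hGR₃ @μ hΔ₁ hΔ₂ hΔ₃) V c)) V c i Γ) :
    ω = 0 := by
  obtain ⟨j, hj, hfam⟩ := hJ_ROGT'C_block hHD hI h₁ h₃ hA @hGR @hGR₀ @hGR₁ @hGR₂ @hGR₃ @μ hΔ₁ hΔ₂ hΔ₃ V c hc hV i
  exact towerLift_class_eq_zero_of_blockZeroOne V _ _ hHD hI h₁ h₃ hA j (hD j hj) hΓ
    (thetaOf_pin_mem_hodgeF_one _ V c i Γ hHD hI h₁ h₃ hω) (hfam Γ hΓ ω hω)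

/-- **T5-B, inconsistency form.**  ONE non-zero theta class of slot `i` at a good context REFUTES the `(0,1)`-reading of the isometric
blocks of that slot — no displayed hypothesis involved. [cite: VoisinHodgeI2002, §7.3.2] -/
theorem not_isometric_blockZeroOne_of_thetaOf_ne_zero
    (hHD : exists_isReal_hodgeModel) (hI : hodgePQ_independent_of_hodgeModel)
    (h₁ : BallQuotientUniformised) (h₃ : CMAbelianVarietyRealised) (hA : Arapura2012_Cor_15_4_6)
    (hc : GOG V c) (hV : IsAnisotropic L V.Hm) (i : Fin 4)
    {Γ : Level V} (hΓ : Γ.BelowConjThree)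
    {ω : (picardCMUniverse hHD hI h₁ h₃).CohC ((picardCMUniverse hHD hI h₁ h₃).pms L ι₁ V Γ) 1}
    (hω : ω ∈ thetaOf _ (thetaClassInputOf _ (fun V c => thetaSpaceInputOf hHD hI h₁ h₃
        (SROGT'C @hGR @hGR₀ @hGR₁ @hGR₂ @hGR₃ @μ hΔ₁ hΔ₂ hΔ₃) V c)) V c i Γ) (hne : ω ≠ 0) :
    ¬ ∀ j : I V (repAt (⟨c.D.a i, c.D.a_real i, c.D.a_ne i⟩ : RealScalar L)) (muLiu ι₁ GramClass.rep),
      (∃ z : (L : Type), z ≠ 0 ∧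
        (line V (repAt (⟨c.D.a i, c.D.a_real i, c.D.a_ne i⟩ : RealScalar L)) (muLiu ι₁ GramClass.rep) j).scalar =
          z * conjRingHomK L z * c.D.a i) →
      ∃ Γ₁ : Level V, ∀ Γ' ≤ Γ₁,
        ∀ y ∈ (liuDictionaryPin hHD hI h₁ h₃ hA V
            (I V (repAt (⟨c.D.a i, c.D.a_real i, c.D.a_ne i⟩ : RealScalar L)) (muLiu ι₁ GramClass.rep))
            (line V (repAt (⟨c.D.a i, c.D.a_real i, c.D.a_ne i⟩ : RealScalar L)) (muLiu ι₁ GramClass.rep))).block j,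
          y ∈ fixedBy Γ'.K (liuDictionaryPin hHD hI h₁ h₃ hA V
            (I V (repAt (⟨c.D.a i, c.D.a_real i, c.D.a_ne i⟩ : RealScalar L)) (muLiu ι₁ GramClass.rep))
            (line V (repAt (⟨c.D.a i, c.D.a_real i, c.D.a_ne i⟩ : RealScalar L)) (muLiu ι₁ GramClass.rep))).H →
          (liuDictionaryPin hHD hI h₁ h₃ hA V
            (I V (repAt (⟨c.D.a i, c.D.a_real i, c.D.a_ne i⟩ : RealScalar L)) (muLiu ι₁ GramClass.rep))
            (line V (repAt (⟨c.D.a i, c.D.a_real i, c.D.a_ne i⟩ : RealScalar L)) (muLiu ι₁ GramClass.rep))).res Γ' y ∈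
            ((picardCMUniverse hHD hI h₁ h₃).hodge ((picardCMUniverse hHD hI h₁ h₃).pms L ι₁ V Γ') 1).piece 0 1 :=
  fun hD => hne (thetaOf_eq_zero_of_isometric_blockZeroOne @hGR @hGR₀ @hGR₁ @hGR₂ @hGR₃ @μ hΔ₁ hΔ₂ hΔ₃
    V c hHD hI h₁ h₃ hA hc hV i hD Γ hΓ hω)

end Isometric

end Summit.HodgeConjecture.CorCM.D2Bridge

end
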